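import Summits.NavierStokesRegularity.NavierStokesRegularity.Theorems.SymmetryModuliCountFiniteTangentModuliMildStubEquicontinuous
import Literature.Analysis.UnboundedOperators.HeatKernelHeatEquation
import HarnessLib

/-!
# Crux `FiniteTangentModuliMild` (stmt-NavierStokesRegularity-14049): the perturbative regime

Line `packing-observability` (lead file; lands `--supports stmt-NavierStokesRegularity-14049`).
**The x-bounded tempered linearised-mild tangent class about a Type-I drift with SMALL constant is
trivial**, hence the crux holds there with `N = 0`, and both observability stubs of the line
(`stub_obsTime`, `stub_obsSpace`) hold vacuously for such drifts. This is the "linear perturbative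
KNSS Liouville" sanity column of the item's gloss, made a theorem, with a scale-free proof that needs
neither the Volterra/Beta integrals `∫_{-∞}^t (t-τ)^{-1/2}(-τ)^{-1} dτ = π/√(-t)` nor any regularity:

* `norm_le_geometric_of_small_drift` — ONE restart of the linearised Oseen identity from `s = 4t` to
  `t < 0`: the caloric term is bounded by `sup ‖v(4t,·)‖ ≤ K w(4t) ≤ (K/2) w(t)`
  (`w(t) = 1/√(−t) + 1/(−t)`; sup-contraction `UnboundedOperators.norm_heatExtension_le`), and the
  symmetrised Duhamel term over `(4t, t)` — drift bounded there by `C/√(−t)`, field by `K w(t)` — is at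
  most `c · (C/√(−t)) · (K w(t)) · 2√(3(−t)) ≤ 4 c C K w(t)` (`exists_norm_integral_oseenKernel_symm_le`,
  the landed helper of stub 3). So the envelope constant improves from `K` to `(1/2 + 4cC) K ≤ (3/4) K`
  once `C ≤ 1/(16c)`; iterating, `‖v(t,x)‖ ≤ (3/4)ⁿ K w(t)` for every `n`.
* `tangent_eq_zero_of_small_drift` — hence `v ≡ 0` on `t < 0`.
* `finiteTangentModuliMild_of_small_drift` — the crux's conclusion (verbatim conjuncts) for every
  drift with `HasTypeITimeDecay C u`, `C ≤ c₀`, with `N = 0`.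

Only the Type-I bound of the drift, the velocity envelope and the Oseen identity are used (no
smoothness, divergence, pressure or PDE conjunct) — consistent with Disproof §1 (the identity is
load-bearing) and §2 (`u = 0`).
-/

noncomputable section

open Set Function Filter Topology MeasureTheory
open Literature.Analysis Literature.Analysis.FluidPDE

set_option linter.dupNamespace false

namespace Summit.NavierStokesRegularity.NavierStokesRegularity.Theorems

/-- Local notation for physical space `ℝ³ = EuclideanSpace ℝ (Fin 3)`. -/
local notation "ℝ³" => EuclideanSpace ℝ (Fin 3)

/-- Weight comparison for the restart from `4t`: `1/√(−4t) + 1/(−4t) ≤ (1/2)(1/√(−t) + 1/(−t))`. -/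
theorem weight_four_mul_le {t : ℝ} (ht : t < 0) :
    1 / Real.sqrt (-(4 * t)) + 1 / (-(4 * t)) ≤ (1 / 2) * (1 / Real.sqrt (-t) + 1 / (-t)) := by
  have ha : 0 < -t := by linarith
  have hs : Real.sqrt (-(4 * t)) = 2 * Real.sqrt (-t) := by
    rw [show -(4 * t) = 2 ^ 2 * (-t) by ring, Real.sqrt_mul (by norm_num) (-t), Real.sqrt_sq (by norm_num)]
  have hsq : 0 < Real.sqrt (-t) := Real.sqrt_pos.2 ha
  rw [hs, show -(4 * t) = 4 * (-t) by ring]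
  have h1 : 1 / (4 * (-t)) ≤ (1 / 2) * (1 / (-t)) := by
    have he : 1 / (4 * (-t)) = (1 / 4) * (1 / (-t)) := by field_simp
    have hp : 0 < 1 / (-t) := by positivity
    rw [he]
    nlinarith
  have h2 : 1 / (2 * Real.sqrt (-t)) = (1 / 2) * (1 / Real.sqrt (-t)) := by
    field_simp
  rw [h2]
  linarith

/-- The weight `1/√(−τ) + 1/(−τ)` is monotone towards the final time: for `τ < t < 0`... stated as
`-t ≤ -τ`, `t < 0` ⇒ `w(τ) ≤ w(t)`. -/
theorem weight_mono {t τ : ℝ} (ht : t < 0) (hτ : τ ≤ t) :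
    1 / Real.sqrt (-τ) + 1 / (-τ) ≤ 1 / Real.sqrt (-t) + 1 / (-t) := by
  have ha : 0 < -t := by linarith
  have hb : -t ≤ -τ := by linarith
  have h1 : 1 / (-τ) ≤ 1 / (-t) := one_div_le_one_div_of_le ha hb
  have h2 : 1 / Real.sqrt (-τ) ≤ 1 / Real.sqrt (-t) :=
    one_div_le_one_div_of_le (Real.sqrt_pos.2 ha) (Real.sqrt_le_sqrt hb)
  linarith

/-- **One restart improves the envelope.** With `c` the constant of
`exists_norm_integral_oseenKernel_symm_le`: if `‖u(τ,y)‖ ≤ C/√(−τ)` (`τ < 0`), `4 c C ≤ 1/4`, and `v`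
obeys the envelope `‖v(τ,y)‖ ≤ K/√(−τ) + K/(−τ)` together with the linearised Oseen identity for all
`s < t < 0`, then `‖v(t,x)‖ ≤ (3/4)(K/√(−t) + K/(−t))`. -/
theorem norm_le_three_quarters_of_small_drift {c : ℝ} (hc : 0 < c)
    (hD : ∀ {u v : ℝ → ℝ³ → ℝ³} {s t M₁ M₂ : ℝ}, s < t → 0 ≤ M₁ → 0 ≤ M₂ →
      (∀ τ ∈ Ioo s t, ∀ y, ‖u τ y‖ ≤ M₁) → (∀ τ ∈ Ioo s t, ∀ y, ‖v τ y‖ ≤ M₂) → ∀ x : ℝ³,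
        ‖∫ τ in Ioo s t, ∫ y, (oseenKernel (t - τ) (x - y) (u τ y) (v τ y) +
            oseenKernel (t - τ) (x - y) (v τ y) (u τ y))‖ ≤ c * (M₁ * M₂) * (2 * Real.sqrt (t - s)))
    {C : ℝ} (hCc : 4 * c * C ≤ 1 / 4) {u v : ℝ → ℝ³ → ℝ³} (hu : HasTypeITimeDecay C u) {K : ℝ}
    (hK : ∀ t < 0, ∀ x, ‖v t x‖ ≤ K / Real.sqrt (-t) + K / (-t))
    (hmild : ∀ s t : ℝ, s < t → t < 0 → ∀ x, v t x = heatFlow (v s) (t - s) x -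
      ∫ τ in Set.Ioo s t, ∫ y, (oseenKernel (t - τ) (x - y) (u τ y) (v τ y) +
        oseenKernel (t - τ) (x - y) (v τ y) (u τ y)))
    {t : ℝ} (ht : t < 0) (x : ℝ³) : ‖v t x‖ ≤ (3 / 4) * (K / Real.sqrt (-t) + K / (-t)) := by
  have ha : 0 < -t := by linarith
  have hsq : 0 < Real.sqrt (-t) := Real.sqrt_pos.2 ha
  have hw : 0 < 1 / Real.sqrt (-t) + 1 / (-t) := by positivity
  -- signs of the constants, read off the hypotheses at `(t, x)`
  have hC0 : 0 ≤ C := by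
    have h := hu t ht x
    have : 0 ≤ C / Real.sqrt (-t) := (norm_nonneg _).trans h
    by_contra hneg
    have : C / Real.sqrt (-t) < 0 := div_neg_of_neg_of_pos (lt_of_not_ge hneg) hsq
    linarith
  have hKw : ∀ τ < 0, K / Real.sqrt (-τ) + K / (-τ) = K * (1 / Real.sqrt (-τ) + 1 / (-τ)) := by
    intro τ _; ring
  have hK0 : 0 ≤ K := by
    have h := hK t ht x
    rw [hKw t ht] at h
    have h0 : 0 ≤ K * (1 / Real.sqrt (-t) + 1 / (-t)) := (norm_nonneg _).trans h
    by_contra hneg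
    have : K * (1 / Real.sqrt (-t) + 1 / (-t)) < 0 := mul_neg_of_neg_of_pos (lt_of_not_ge hneg) hw
    linarith
  -- the restart from `s = 4t`
  have hs : 4 * t < t := by linarith
  have hid := hmild (4 * t) t hs ht x
  -- caloric term
  have hheat : ‖heatFlow (v (4 * t)) (t - 4 * t) x‖ ≤ (1 / 2) * (K * (1 / Real.sqrt (-t) + 1 / (-t))) := by
    rw [heatFlow_of_pos _ (by linarith : 0 < t - 4 * t)]
    have h4 : 4 * t < 0 := by linarith
    have hb : ∀ z, ‖v (4 * t) z‖ ≤ K * (1 / Real.sqrt (-(4 * t)) + 1 / (-(4 * t))) := fun z => by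
      rw [← hKw _ h4]; exact hK _ h4 z
    refine (UnboundedOperators.norm_heatExtension_le hb (by linarith) x).trans ?_
    have := weight_four_mul_le ht
    nlinarith
  -- Duhamel term over `(4t, t)`: drift ≤ C/√(-t), field ≤ K w(t)
  have hM₁ : ∀ τ ∈ Ioo (4 * t) t, ∀ y, ‖u τ y‖ ≤ C / Real.sqrt (-t) := by
    intro τ hτ y
    have hτ0 : τ < 0 := hτ.2.trans ht
    refine (hu τ hτ0 y).trans ?_
    exact div_le_div_of_nonneg_left hC0 hsq (Real.sqrt_le_sqrt (by linarith [hτ.2]))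
  have hM₂ : ∀ τ ∈ Ioo (4 * t) t, ∀ y, ‖v τ y‖ ≤ K * (1 / Real.sqrt (-t) + 1 / (-t)) := by
    intro τ hτ y
    have hτ0 : τ < 0 := hτ.2.trans ht
    have h := hK τ hτ0 y
    rw [hKw τ hτ0] at h
    exact h.trans (mul_le_mul_of_nonneg_left (weight_mono ht hτ.2.le) hK0)
  have hduh := hD hs (div_nonneg hC0 hsq.le) (mul_nonneg hK0 hw.le) hM₁ hM₂ x
  have hsqrt3 : Real.sqrt (t - 4 * t) ≤ 2 * Real.sqrt (-t) := by
    rw [show t - 4 * t = 3 * (-t) by ring, Real.sqrt_mul (by norm_num) (-t)]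
    have : Real.sqrt 3 ≤ 2 := by
      rw [show (2 : ℝ) = Real.sqrt 4 by rw [show (4 : ℝ) = 2 ^ 2 by norm_num, Real.sqrt_sq (by norm_num)]]
      exact Real.sqrt_le_sqrt (by norm_num)
    nlinarith
  have hduh' : ‖∫ τ in Ioo (4 * t) t, ∫ y, (oseenKernel (t - τ) (x - y) (u τ y) (v τ y) +
      oseenKernel (t - τ) (x - y) (v τ y) (u τ y))‖ ≤ 4 * c * C * (K * (1 / Real.sqrt (-t) + 1 / (-t))) := by
    refine hduh.trans ?_
    have hkw : 0 ≤ K * (1 / Real.sqrt (-t) + 1 / (-t)) := mul_nonneg hK0 hw.le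
    calc c * (C / Real.sqrt (-t) * (K * (1 / Real.sqrt (-t) + 1 / (-t)))) * (2 * Real.sqrt (t - 4 * t))
        ≤ c * (C / Real.sqrt (-t) * (K * (1 / Real.sqrt (-t) + 1 / (-t)))) * (2 * (2 * Real.sqrt (-t))) := by
          apply mul_le_mul_of_nonneg_left (by linarith) (by positivity)
      _ = 4 * c * C * (K * (1 / Real.sqrt (-t) + 1 / (-t))) * (Real.sqrt (-t) / Real.sqrt (-t)) := by ring
      _ = 4 * c * C * (K * (1 / Real.sqrt (-t) + 1 / (-t))) := by rw [div_self hsq.ne', mul_one]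
  -- assemble
  have hkw : 0 ≤ K * (1 / Real.sqrt (-t) + 1 / (-t)) := mul_nonneg hK0 hw.le
  calc ‖v t x‖ = ‖heatFlow (v (4 * t)) (t - 4 * t) x - ∫ τ in Ioo (4 * t) t, ∫ y,
        (oseenKernel (t - τ) (x - y) (u τ y) (v τ y) + oseenKernel (t - τ) (x - y) (v τ y) (u τ y))‖ := by
          rw [← hid]
    _ ≤ (1 / 2) * (K * (1 / Real.sqrt (-t) + 1 / (-t))) + 4 * c * C * (K * (1 / Real.sqrt (-t) + 1 / (-t))) :=
          (norm_sub_le _ _).trans (add_le_add hheat hduh')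
    _ ≤ (1 / 2) * (K * (1 / Real.sqrt (-t) + 1 / (-t))) + (1 / 4) * (K * (1 / Real.sqrt (-t) + 1 / (-t))) := by
          nlinarith
    _ = (3 / 4) * (K / Real.sqrt (-t) + K / (-t)) := by rw [hKw t ht]; ring

/-- **Geometric improvement.** Under the hypotheses of `norm_le_three_quarters_of_small_drift`, the
envelope holds with constant `(3/4)ⁿ K` for every `n`. -/
theorem norm_le_geometric_of_small_drift {c : ℝ} (hc : 0 < c)
    (hD : ∀ {u v : ℝ → ℝ³ → ℝ³} {s t M₁ M₂ : ℝ}, s < t → 0 ≤ M₁ → 0 ≤ M₂ →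
      (∀ τ ∈ Ioo s t, ∀ y, ‖u τ y‖ ≤ M₁) → (∀ τ ∈ Ioo s t, ∀ y, ‖v τ y‖ ≤ M₂) → ∀ x : ℝ³,
        ‖∫ τ in Ioo s t, ∫ y, (oseenKernel (t - τ) (x - y) (u τ y) (v τ y) +
            oseenKernel (t - τ) (x - y) (v τ y) (u τ y))‖ ≤ c * (M₁ * M₂) * (2 * Real.sqrt (t - s)))
    {C : ℝ} (hCc : 4 * c * C ≤ 1 / 4) {u v : ℝ → ℝ³ → ℝ³} (hu : HasTypeITimeDecay C u) {K : ℝ}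
    (hK : ∀ t < 0, ∀ x, ‖v t x‖ ≤ K / Real.sqrt (-t) + K / (-t))
    (hmild : ∀ s t : ℝ, s < t → t < 0 → ∀ x, v t x = heatFlow (v s) (t - s) x -
      ∫ τ in Set.Ioo s t, ∫ y, (oseenKernel (t - τ) (x - y) (u τ y) (v τ y) +
        oseenKernel (t - τ) (x - y) (v τ y) (u τ y)))
    (n : ℕ) : ∀ t < 0, ∀ x, ‖v t x‖ ≤ (3 / 4) ^ n * K / Real.sqrt (-t) + (3 / 4) ^ n * K / (-t) := by
  induction n with
  | zero => simpa using hK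
  | succ n ih =>
      intro t ht x
      have h := norm_le_three_quarters_of_small_drift hc hD hCc hu ih hmild ht x
      calc ‖v t x‖ ≤ (3 / 4) * ((3 / 4) ^ n * K / Real.sqrt (-t) + (3 / 4) ^ n * K / (-t)) := h
        _ = (3 / 4) ^ (n + 1) * K / Real.sqrt (-t) + (3 / 4) ^ (n + 1) * K / (-t) := by ring

/-- **The tangent class about a small Type-I drift is trivial.** There is an absolute constant
`c₀ > 0` such that for every drift with `‖u(t,x)‖ ≤ C/√(−t)`, `C ≤ c₀`, every field with the
x-bounded tempered envelope obeying the linearised Oseen identity about `u` vanishes on `t < 0`. -/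
theorem tangent_eq_zero_of_small_drift : ∃ c₀ : ℝ, 0 < c₀ ∧ ∀ (C : ℝ) (u v : ℝ → ℝ³ → ℝ³), C ≤ c₀ →
    HasTypeITimeDecay C u →
    (∃ K : ℝ, ∀ t < 0, ∀ x, ‖v t x‖ ≤ K / Real.sqrt (-t) + K / (-t)) →
    (∀ s t : ℝ, s < t → t < 0 → ∀ x, v t x = heatFlow (v s) (t - s) x -
      ∫ τ in Set.Ioo s t, ∫ y, (oseenKernel (t - τ) (x - y) (u τ y) (v τ y) +
        oseenKernel (t - τ) (x - y) (v τ y) (u τ y))) →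
    ∀ t < 0, ∀ x, v t x = 0 := by
  obtain ⟨c, hc, hD⟩ := exists_norm_integral_oseenKernel_symm_le (E := ℝ³)
  refine ⟨1 / (16 * c), by positivity, fun C u v hC hu ⟨K, hK⟩ hmild t ht x => ?_⟩
  have hCc : 4 * c * C ≤ 1 / 4 := by
    have h1 : 4 * c * C ≤ 4 * c * (1 / (16 * c)) := mul_le_mul_of_nonneg_left hC (by positivity)
    have h2 : 4 * c * (1 / (16 * c)) = 1 / 4 := by field_simp; ring
    linarith
  have hgeo := fun n => norm_le_geometric_of_small_drift hc
    (fun {u v s t M₁ M₂} hst h1 h2 hu' hv' x => hD hst h1 h2 hu' hv' x) hCc hu hK hmild n t ht x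
  have hlim : Tendsto (fun n : ℕ => (3 / 4 : ℝ) ^ n * K / Real.sqrt (-t) + (3 / 4) ^ n * K / (-t))
      atTop (𝓝 0) := by
    have hp : Tendsto (fun n : ℕ => (3 / 4 : ℝ) ^ n) atTop (𝓝 0) :=
      tendsto_pow_atTop_nhds_zero_of_lt_one (by norm_num) (by norm_num)
    have h1 : Tendsto (fun n : ℕ => (3 / 4 : ℝ) ^ n * K / Real.sqrt (-t)) atTop (𝓝 0) := by
      simpa using (hp.mul_const K).div_const (Real.sqrt (-t))
    have h2 : Tendsto (fun n : ℕ => (3 / 4 : ℝ) ^ n * K / (-t)) atTop (𝓝 0) := by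
      simpa using (hp.mul_const K).div_const (-t)
    simpa using h1.add h2
  have hle : ‖v t x‖ ≤ 0 := ge_of_tendsto' hlim hgeo
  exact norm_le_zero_iff.1 hle

/-- **The crux in the perturbative regime (`N = 0`).** There is `c₀ > 0` such that for every drift
`u` with `HasTypeITimeDecay C u`, `C ≤ c₀` (smoothness, divergence and the gradient bound are not even
needed), ANY single pair `(v, q)` in the x-bounded tempered linearised-mild class (the six conjuncts of
`FiniteTangentModuliMild`, verbatim) has `v ≡ 0` on `t < 0`; in particular the conclusion of the crux
holds with `N = 0`. -/
theorem finiteTangentModuliMild_of_small_drift : ∃ c₀ : ℝ, 0 < c₀ ∧ ∀ (C : ℝ) (u : ℝ → ℝ³ → ℝ³),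
    C ≤ c₀ → HasTypeITimeDecay C u →
    ∀ (v : Fin (0 + 1) → ℝ → ℝ³ → ℝ³) (q : Fin (0 + 1) → ℝ → ℝ³ → ℝ),
      (∀ i, (ContDiffOn ℝ (⊤ : ℕ∞) (Function.uncurry (v i)) (Set.Iio 0 ×ˢ Set.univ) ∧
        ContDiffOn ℝ (⊤ : ℕ∞) (Function.uncurry (q i)) (Set.Iio 0 ×ˢ Set.univ) ∧
        (∃ K : ℝ, ∀ t < 0, ∀ x, ‖(v i) t x‖ ≤ K / Real.sqrt (-t) + K / (-t) ∧
          |(q i) t x| ≤ K / (-t) + K * (1 + ‖x‖) / Real.sqrt (-t) ^ 3) ∧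
        (∀ t < 0, VectorCalculus.IsDivFree ((v i) t)) ∧
        (∀ t < 0, ∀ x, timeDeriv (v i) t x + convect (u t) ((v i) t) x + convect ((v i) t) (u t) x =
          Laplacian.laplacian ((v i) t) x - gradient ((q i) t) x) ∧
        (∀ s t : ℝ, s < t → t < 0 → ∀ x, (v i) t x = heatFlow ((v i) s) (t - s) x -
          ∫ τ in Set.Ioo s t, ∫ y, (oseenKernel (t - τ) (x - y) (u τ y) ((v i) τ y) +
            oseenKernel (t - τ) (x - y) ((v i) τ y) (u τ y))))) →
      ∃ c : Fin (0 + 1) → ℝ, c ≠ 0 ∧ ∀ t < 0, ∀ x, ∑ i, c i • v i t x = 0 := by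
  obtain ⟨c₀, hc₀, h⟩ := tangent_eq_zero_of_small_drift
  refine ⟨c₀, hc₀, fun C u hC hu v q hvq => ⟨fun _ => 1, ?_, fun t ht x => ?_⟩⟩
  · intro h0
    simpa using congrFun h0 0
  · obtain ⟨K, hK⟩ := (hvq 0).2.2.1
    have hz : ∀ i, v i t x = 0 := fun i => by
      obtain ⟨K, hK⟩ := (hvq i).2.2.1
      exact h C u (v i) hC hu ⟨K, fun t ht x => (hK t ht x).1⟩ (hvq i).2.2.2.2.2 t ht x
    simp [hz]

end Summit.NavierStokesRegularity.NavierStokesRegularity.Theorems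

end
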